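import Literature.NumberTheory.Automorphic.CongruenceSubgroupPropertySL2Mennicke
import Literature.NumberTheory.Automorphic.CongruenceSubgroupPropertySL2Signs
import Literature.NumberTheory.Automorphic.QuaternionRamificationParityHolds
import Literature.NumberTheory.QuadraticForms.CyclotomicHilbertReciprocity
import Literature.NumberTheory.QuadraticForms.HilbertSymbolUnramified
import Literature.NumberTheory.QuadraticForms.HilbertSymbolArchimedean
import HarnessLib

/-!
# Serre's congruence subgroup property for `SL₂(𝓞_F)` — proofs, VI: Mennicke symbols are trivial
# over a ring of integers with a real place (Bass–Milnor–Serre, Ch. I Thm. 3.5 Case 1 and Thm. 3.6)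

Topic `Literature/NumberTheory/Automorphic`; namespace `Literature.NumberTheory.Automorphic`
(sub-namespace `SerreSL2`).  Everything here is PROVED; no definitions, no named facts.

**BMS Thm. 3.6**: "If `A` is not totally imaginary then, for all ideals `𝔮 ≠ 0`, all Mennicke
symbols on `W_𝔮` are trivial."  We prove it for `A = 𝓞_K`, `K` a number field with a real embedding
`σ`, and principal `𝔮 = (q)` (the case needed for Serre's theorem):
`SerreSL2.MennickeSymbol.sym_eq_one`.  By `sym_sq_eq_one` (file `…Mennicke`, Thm. 3.6 (i)–(ii)) every
symbol value has order dividing `2`, so it remains to show (Thm. 3.6 (iii)) that every value is a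
square, which is **Thm. 3.5, Case 1** (`p = 2`, `n = 1`, the non-complex place `𝔭_∞ = σ`,
`u = v = -1`), followed verbatim:

1. replace `a` by `a' = a + tb` prime to `2` (MS1);
2. Dirichlet: a prime `b₁ A` with `b₁ ≡ b' (mod a')` (`b = b'q`), `b₁ ≡ 1 (mod 8)` ("close to `1`" at
   the dyadic places, so `b₁ ∈ K_𝔭²` for `𝔭 ∣ 2`), `σ(b₁) < 0` ("close to `v = -1` at `𝔭_∞`") and
   `b₁ > 0` at the other real places; `[b'q over a'] = [b₁q over a']` (Lemma 2.7 (c));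
3. Dirichlet: a prime `a₁ A ∤ 2` with `a₁ ≡ a' (mod b₁q)` and `σ(a₁) < 0` iff `a'` is a non-square
   modulo `b₁` ("close to `uⁱ` at `𝔭_∞`"); `[b₁q over a'] = [b₁q over a₁]` (MS1);
4. Hilbert reciprocity for `(a₁, b₁)` (O'Meara 71:18, the tree's `hilbertReciprocity_holds`, BMS
   (A.21)): the symbol is `1` at the dyadic places (`b₁ ∈ K_𝔭²`), at the finite places prime to
   `2a₁b₁` (units, (A.16)), at the complex places and at the real places `≠ σ` (`b₁ > 0`); at `(b₁)`
   it is the quadratic character of `a₁ ≡ a'`, at `σ` it is `-1` iff `σ(a₁) < 0`, and these two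
   agree by the choice of the sign; so the symbol at `(a₁)` is `1`: `b₁ ≡ c² (mod a₁)`;
5. `[b₁q over a₁] = [c²q over a₁] = [cq over a₁]² = 1` (Lemma 2.7 (c), 2.9 (a), `sym_sq_eq_one`).

## References

* [BassMilnorSerre1967] H. Bass, J. Milnor, J.-P. Serre, Publ. Math. IHES 33 (1967), Ch. I,
  Thm. 3.5 (Case 1), Thm. 3.6, Appendix (A.10), (A.16), (A.21).
* [SerreSL2Congruence1970] J.-P. Serre, Ann. of Math. 92 (1970), §2.
-/

open NumberField IsDedekindDomain InfinitePlace

namespace Literature.NumberTheory.Automorphic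

namespace SerreSL2

open Literature.NumberTheory.QuadraticForms

variable {K : Type} [Field K] [NumberField K]

/-! ### Local evaluations of the quadratic Hilbert symbol -/

/-- At a dyadic place, `b ≡ 1 (mod 8)` is a local square, so `(a, b)_v = 1`. [folklore] -/
theorem hilbertSymbol_eq_one_of_dyadic (v : HeightOneSpectrum (𝓞 K)) (h2 : (2 : 𝓞 K) ∈ v.asIdeal)
    {b : 𝓞 K} (hb : b - 1 ∈ Ideal.span {(8 : 𝓞 K)}) (hb0 : b ≠ 0) (a : K) :
    hilbertSymbol (v.adicCompletion K) (algebraMap K _ a) (algebraMap K _ b) = 1 := by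
  obtain ⟨k, hk⟩ := Ideal.mem_span_singleton'.1 hb
  have hb' : b = 1 + 4 * (2 * k) := by linear_combination -hk
  have hsq : IsSquare (algebraMap K (v.adicCompletion K) (b : K)) := by
    rw [← algebraMap_ringOfIntegers_adicCompletion, hb']
    exact isSquare_one_add_four_mul_adicCompletion_of_exists K v h2
      ⟨0, by simpa using v.asIdeal.neg_mem (v.asIdeal.mul_mem_right k h2)⟩
  rw [hilbertSymbol_comm]
  exact hilbertSymbol_eq_one_of_isSquare hsq
    ((map_ne_zero _).2 (RingOfIntegers.coe_ne_zero_iff.2 hb0)) _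

/-- `ord_v π = 1` for a generator `π` of the prime `v`. [folklore] -/
theorem ordAt_eq_one_of_span_eq (v : HeightOneSpectrum (𝓞 K)) {π : 𝓞 K}
    (hπ : v.asIdeal = Ideal.span {π}) : ordAt v π = 1 := by
  classical
  unfold ordAt
  rw [← hπ]
  convert Associates.count_self (Associates.irreducible_mk.mpr v.irreducible)

/-- At a non-dyadic prime `v = (π)` and for a `v`-unit `u`: `(π, u)_v = -1` iff `u` is a non-square
modulo `v` (the tame symbol, O'Meara 63:11a; BMS (A.16)–(A.17)). [folklore] -/
theorem hilbertSymbol_eq_neg_one_iff_of_span_eq (v : HeightOneSpectrum (𝓞 K))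
    (h2 : (2 : 𝓞 K) ∉ v.asIdeal) {π u : 𝓞 K} (hπ : v.asIdeal = Ideal.span {π}) (hu : u ∉ v.asIdeal) :
    hilbertSymbol (v.adicCompletion K) (algebraMap K _ π) (algebraMap K _ u) = -1 ↔
      ¬ IsSquare (Ideal.Quotient.mk v.asIdeal u) := by
  have hπ0 : π ≠ 0 := fun h ↦ v.ne_bot (by rw [hπ, h, Ideal.span_singleton_eq_bot])
  rw [hilbertSymbol_eq_neg_one_iff_of_not_mem K v h2 hu hπ0, ordAt_eq_one_of_span_eq v hπ]
  simp

/-- At a non-dyadic place `v` and for `v`-units `a ≠ 0`, `b`: `(a, b)_v = 1` (BMS (A.16)). [folklore] -/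
theorem hilbertSymbol_eq_one_of_not_mem (v : HeightOneSpectrum (𝓞 K)) (h2 : (2 : 𝓞 K) ∉ v.asIdeal)
    {a b : 𝓞 K} (ha0 : a ≠ 0) (ha : a ∉ v.asIdeal) (hb : b ∉ v.asIdeal) :
    hilbertSymbol (v.adicCompletion K) (algebraMap K _ a) (algebraMap K _ b) = 1 := by
  refine hilbertSymbol_eq_one_of_even_ordAt K v h2 hb ha0 ?_
  have h0 : ordAt v a = 0 := by
    by_contra h
    exact ha ((ordAt_ne_zero_iff K ha0 v).1 h)
  rw [h0]
  exact Even.zero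

omit [NumberField K] in
/-- A real embedding is a real complex embedding. [folklore] -/
theorem isReal_algebraMap_comp (σ : K →+* ℝ) : ComplexEmbedding.IsReal ((algebraMap ℝ ℂ).comp σ) := by
  rw [ComplexEmbedding.isReal_iff]
  ext1 x
  rw [ComplexEmbedding.conjugate_coe_eq, RingHom.comp_apply, Complex.coe_algebraMap,
    Complex.conj_ofReal]

omit [NumberField K] in
/-- The real embedding of a real place `w` is `σ` iff `w` is the place of `σ`. [folklore] -/
theorem embedding_of_isReal_eq_iff {w : InfinitePlace K} (hw : w.IsReal) (σ : K →+* ℝ) :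
    embedding_of_isReal hw = σ ↔ w = InfinitePlace.mk ((algebraMap ℝ ℂ).comp σ) := by
  constructor
  · rintro rfl
    conv_lhs => rw [← mk_embedding w]
    congr 1
    ext1 x
    exact (embedding_of_isReal_apply hw x).symm
  · rintro rfl
    ext1 x
    apply Complex.ofReal_injective
    rw [embedding_of_isReal_apply, embedding_mk_eq_of_isReal (isReal_algebraMap_comp σ)]
    rfl

/-! ### BMS Thm. 3.5 (Case 1) and Thm. 3.6: all Mennicke symbols are trivial -/

namespace MennickeSymbol

variable {q : 𝓞 K} {C : Type*} [Group C] (M : MennickeSymbol (Ideal.span {q}) C)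

/-- **Bass–Milnor–Serre, Ch. I Thm. 3.6 (with Thm. 3.5, Case 1)** for `A = 𝓞_K`, `K` a number field
with a real embedding `σ`, and `𝔮 = (q)`: **every Mennicke symbol on `W_𝔮` is trivial**,
`[b over a] = 1` for all `(a, b) ∈ W_𝔮`.  See the module docstring for the proof (BMS's, with
`p = 2`, `n = 1`, `𝔭_∞ = σ`). [cite: BassMilnorSerre1967, Ch. I Thm. 3.5 (Case 1) and Thm. 3.6] -/
theorem sym_eq_one (σ : K →+* ℝ) {a b : 𝓞 K} (ha : a - 1 ∈ Ideal.span {q})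
    (hb : b ∈ Ideal.span {q}) (hab : IsCoprime a b) : M.sym a b = 1 := by
  classical
  obtain ⟨b', rfl⟩ := Ideal.mem_span_singleton'.mp hb
  by_cases hb0 : b' * q = 0
  · rw [hb0] at hab ⊢
    have hau : IsUnit a := isCoprime_zero_right.mp hab
    exact M.sym_eq_one_of_eq_unit_add (-1) hau.unit ha (Ideal.zero_mem _) hab (by simp)
  have hq0 : q ≠ 0 := right_ne_zero_of_mul hb0
  have hqmem : q ∈ Ideal.span {q} := Ideal.mem_span_singleton_self q
  have hmulq : ∀ c : 𝓞 K, c * q ∈ Ideal.span {q} := fun c ↦ Ideal.mul_mem_left _ c hqmem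
  -- Step 1: `a' = a + t b` prime to `2`
  have h2u : ¬ IsUnit (2 : 𝓞 K) := by
    have := not_isUnit_natCast_of_prime (K := K) Nat.prime_two
    norm_num at this
    exact this
  obtain ⟨t, ht2, ha'0⟩ := exists_add_mul_isCoprime hab (w := 2) two_ne_zero h2u
  set a' := a + t * (b' * q) with ha'def
  have ha' : a' - 1 ∈ Ideal.span {q} := by
    have : a' - 1 = (a - 1) + (t * b') * q := by rw [ha'def]; ring
    rw [this]; exact Ideal.add_mem _ ha (hmulq _)
  have ha'b : IsCoprime a' (b' * q) := hab.add_mul_right_left t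
  have ha'b' : IsCoprime a' b' := ha'b.of_mul_right_left
  have ha'q : IsCoprime a' q := ha'b.of_mul_right_right
  have e1 : M.sym a (b' * q) = M.sym a' (b' * q) := (M.ms1_left t ha hb hab).symm
  -- Step 2: `x₁ ≡ b' (mod a')`, `x₁ ≡ 1 (mod 8)`
  have ha'8 : IsCoprime a' 8 := by
    have := ht2.pow_right (n := 3); norm_num at this; exact this
  obtain ⟨u, v, huv⟩ := ha'8
  set x₁ := b' * (v * 8) + u * a' with hx₁
  -- adjust the signs of `x₁` inside its class modulo `8 a'`
  have h8 : (8 : 𝓞 K) ≠ 0 := by norm_num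
  have h𝔪 : Ideal.span {8 * a'} ≠ ⊥ := by
    rw [Ne, Ideal.span_singleton_eq_bot]; exact mul_ne_zero h8 ha'0
  obtain ⟨x, hxx₁, hxsign⟩ := exists_sub_mem_and_sign h𝔪 x₁ (fun φ ↦ φ = σ)
  obtain ⟨k₁, hk₁⟩ := Ideal.mem_span_singleton'.1 hxx₁
  have hxσ : σ x < 0 := (hxsign σ).1 rfl
  have hxφ : ∀ φ : K →+* ℝ, φ ≠ σ → 0 < φ x := fun φ hφ ↦ (hxsign φ).2 hφ
  have hx0 : x ≠ 0 := fun h ↦ by rw [h] at hxσ; simp at hxσ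
  have hxcop : IsCoprime (Ideal.span {x}) (Ideal.span {8 * a'}) := by
    rw [Ideal.isCoprime_span_singleton_iff]
    refine IsCoprime.mul_right ?_ ?_
    · have hx8 : x = 1 + (k₁ * a' + v * (b' - 1)) * 8 := by linear_combination -hk₁ + huv
      rw [hx8]; exact isCoprime_one_left.add_mul_right_left _
    · have hxa : x = b' + (k₁ * 8 + u * (1 - b')) * a' := by linear_combination -hk₁ + b' * huv
      rw [hxa]; exact ha'b'.symm.add_mul_right_left _
  have htop : IsCoprime (⊤ : Ideal (𝓞 K)) (Ideal.span {8 * a'}) := by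
    rw [← Ideal.one_eq_top]; exact isCoprime_one_left
  -- Dirichlet: the prime `b₁`
  obtain ⟨vb, -, -, -, b₁, hvb, hb₁x, hb₁sign⟩ :=
    exists_prime_mul_eq_span_singleton h𝔪 (𝔟 := ⊤) top_ne_bot htop hx0 hxcop ∅ Set.finite_empty
  rw [Ideal.mul_top] at hvb
  obtain ⟨k₂, hk₂⟩ := Ideal.mem_span_singleton'.1 hb₁x
  have hb₁vb : b₁ ∈ vb.asIdeal := by rw [hvb]; exact Ideal.mem_span_singleton_self _
  have hb₁0 : b₁ ≠ 0 := fun h ↦ vb.ne_bot (by rw [hvb, h, Ideal.span_singleton_eq_bot])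
  have hb₁σ : σ b₁ < 0 := by
    rcases pos_and_pos_or_neg_and_neg_of_mul_pos (hb₁sign σ) with ⟨-, h⟩ | ⟨h, -⟩
    · exact absurd h (not_lt.2 hxσ.le)
    · exact h
  have hb₁φ : ∀ φ : K →+* ℝ, φ ≠ σ → 0 < φ b₁ := fun φ hφ ↦ by
    rcases pos_and_pos_or_neg_and_neg_of_mul_pos (hb₁sign φ) with ⟨h, -⟩ | ⟨-, h⟩
    · exact h
    · exact absurd h (not_lt.2 (hxφ φ hφ).le)
  have hb₁8 : b₁ - 1 ∈ Ideal.span {(8 : 𝓞 K)} := Ideal.mem_span_singleton'.2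
    ⟨k₂ * a' + k₁ * a' + v * (b' - 1), by linear_combination hk₂ + hk₁ - huv⟩
  have hb₁eq : b₁ = b' + (k₂ * 8 + k₁ * 8 + u * (1 - b')) * a' := by
    linear_combination -hk₂ - hk₁ + b' * huv
  have hb₁a : b₁ - b' ∈ Ideal.span {a'} :=
    Ideal.mem_span_singleton'.2 ⟨k₂ * 8 + k₁ * 8 + u * (1 - b'), by rw [hb₁eq]; ring⟩
  have ha'b₁ : IsCoprime a' b₁ := by rw [hb₁eq]; exact ha'b'.add_mul_right_right _
  have h2vb : (2 : 𝓞 K) ∉ vb.asIdeal := fun h2 ↦ by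
    have h8v : (8 : 𝓞 K) ∈ vb.asIdeal := by
      have := vb.asIdeal.mul_mem_left 4 h2; norm_num at this; exact this
    have h1 : b₁ - (b₁ - 1) ∈ vb.asIdeal := vb.asIdeal.sub_mem hb₁vb
      ((Ideal.span_singleton_le_iff_mem _).2 h8v hb₁8)
    rw [sub_sub_cancel] at h1
    exact vb.isPrime.ne_top ((Ideal.eq_top_iff_one _).2 h1)
  have e2 : M.sym a' (b' * q) = M.sym a' (b₁ * q) := (M.sym_mul_q_eq_of_sub_mem ha' ha'b' hb₁a).symm
  -- Step 3: the prime `a₁`, with sign at `σ` given by the quadratic character of `a'` modulo `b₁`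
  have h𝔪' : Ideal.span {b₁ * q} ≠ ⊥ := by
    rw [Ne, Ideal.span_singleton_eq_bot]; exact mul_ne_zero hb₁0 hq0
  obtain ⟨x', hx'a', hx'sign⟩ := exists_sub_mem_and_sign h𝔪' a' (fun φ ↦ φ = σ ∧ ¬ IsSquare (Ideal.Quotient.mk vb.asIdeal a'))
  obtain ⟨k₃, hk₃⟩ := Ideal.mem_span_singleton'.1 hx'a'
  have hx'0 : x' ≠ 0 := fun h ↦ by
    by_cases hs : IsSquare (Ideal.Quotient.mk vb.asIdeal a')
    · have := (hx'sign σ).2 (fun h' ↦ h'.2 hs)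
      rw [h] at this; simp at this
    · have := (hx'sign σ).1 ⟨rfl, hs⟩
      rw [h] at this; simp at this
  have hx'cop : IsCoprime (Ideal.span {x'}) (Ideal.span {b₁ * q}) := by
    rw [Ideal.isCoprime_span_singleton_iff]
    refine IsCoprime.mul_right ?_ ?_
    · have : x' = a' + (k₃ * q) * b₁ := by linear_combination -hk₃
      rw [this]; exact ha'b₁.add_mul_right_left _
    · have : x' = a' + (k₃ * b₁) * q := by linear_combination -hk₃
      rw [this]; exact ha'q.add_mul_right_left _
  have htop' : IsCoprime (⊤ : Ideal (𝓞 K)) (Ideal.span {b₁ * q}) := by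
    rw [← Ideal.one_eq_top]; exact isCoprime_one_left
  have hSfin : {v : HeightOneSpectrum (𝓞 K) | (2 : 𝓞 K) ∈ v.asIdeal}.Finite := by
    have := Ideal.finite_factors (I := Ideal.span {(2 : 𝓞 K)})
      (by rw [Ne, Ideal.zero_eq_bot, Ideal.span_singleton_eq_bot]; exact two_ne_zero)
    simpa only [Ideal.dvd_span_singleton] using this
  obtain ⟨va, hvaS, -, -, a₁, hva, ha₁x', ha₁sign⟩ :=
    exists_prime_mul_eq_span_singleton h𝔪' (𝔟 := ⊤) top_ne_bot htop' hx'0 hx'cop _ hSfin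
  rw [Ideal.mul_top] at hva
  have h2va : (2 : 𝓞 K) ∉ va.asIdeal := hvaS
  obtain ⟨k₄, hk₄⟩ := Ideal.mem_span_singleton'.1 ha₁x'
  have ha₁va : a₁ ∈ va.asIdeal := by rw [hva]; exact Ideal.mem_span_singleton_self _
  have ha₁0 : a₁ ≠ 0 := fun h ↦ va.ne_bot (by rw [hva, h, Ideal.span_singleton_eq_bot])
  have ha₁eq : a₁ = a' + (k₄ + k₃) * (b₁ * q) := by linear_combination -hk₄ - hk₃
  have ha₁q : a₁ - 1 ∈ Ideal.span {q} := by
    have : a₁ - 1 = (a' - 1) + ((k₄ + k₃) * b₁) * q := by rw [ha₁eq]; ring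
    rw [this]; exact Ideal.add_mem _ ha' (hmulq _)
  have ha₁b₁ : IsCoprime a₁ b₁ := by
    have : a₁ = a' + ((k₄ + k₃) * q) * b₁ := by rw [ha₁eq]; ring
    rw [this]; exact ha'b₁.add_mul_right_left _
  have e3 : M.sym a' (b₁ * q) = M.sym a₁ (b₁ * q) := by
    rw [← M.ms1_left (k₄ + k₃) ha' (hmulq b₁) (isCoprime_mul_q ha' ha'b₁), ← ha₁eq]
  -- `a₁ ∉ vb`, `b₁ ∉ va`, `va ≠ vb`
  obtain ⟨c₁, c₂, hc⟩ := ha₁b₁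
  have ha₁vb : a₁ ∉ vb.asIdeal := fun h ↦ vb.isPrime.ne_top ((Ideal.eq_top_iff_one _).2
    (by rw [← hc]; exact vb.asIdeal.add_mem (vb.asIdeal.mul_mem_left _ h) (vb.asIdeal.mul_mem_left _ hb₁vb)))
  have hb₁va : b₁ ∉ va.asIdeal := fun h ↦ va.isPrime.ne_top ((Ideal.eq_top_iff_one _).2
    (by rw [← hc]; exact va.asIdeal.add_mem (va.asIdeal.mul_mem_left _ ha₁va) (va.asIdeal.mul_mem_left _ h)))
  have hvavb : va ≠ vb := fun h ↦ ha₁vb (h ▸ ha₁va)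
  -- the sign of `a₁` at `σ`
  have ha₁σ : σ a₁ < 0 ↔ ¬ IsSquare (Ideal.Quotient.mk vb.asIdeal a') := by
    constructor
    · intro hneg hs
      have hpos : 0 < σ x' := (hx'sign σ).2 (fun h' ↦ h'.2 hs)
      rcases pos_and_pos_or_neg_and_neg_of_mul_pos (ha₁sign σ) with ⟨h, -⟩ | ⟨-, h⟩
      · exact absurd h (not_lt.2 hneg.le)
      · exact absurd h (not_lt.2 hpos.le)
    · intro hs
      have hneg : σ x' < 0 := (hx'sign σ).1 ⟨rfl, hs⟩
      rcases pos_and_pos_or_neg_and_neg_of_mul_pos (ha₁sign σ) with ⟨-, h⟩ | ⟨h, -⟩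
      · exact absurd h (not_lt.2 hneg.le)
      · exact h
  -- the residue of `a₁` modulo `b₁` is that of `a'`
  have ha₁res : Ideal.Quotient.mk vb.asIdeal a₁ = Ideal.Quotient.mk vb.asIdeal a' := by
    rw [Ideal.Quotient.eq, ha₁eq, add_sub_cancel_left]
    exact vb.asIdeal.mul_mem_left _ (vb.asIdeal.mul_mem_right _ hb₁vb)
  -- Step 4: Hilbert reciprocity for `(a₁, b₁)`
  have ha₁K : (a₁ : K) ≠ 0 := RingOfIntegers.coe_ne_zero_iff.2 ha₁0
  have hb₁K : (b₁ : K) ≠ 0 := RingOfIntegers.coe_ne_zero_iff.2 hb₁0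
  obtain ⟨-, heven⟩ := hilbertReciprocity_holds K (a₁ : K) (b₁ : K) ha₁K hb₁K
  set Sf := {v : HeightOneSpectrum (𝓞 K) |
    hilbertSymbol (v.adicCompletion K) (algebraMap K _ (a₁ : K)) (algebraMap K _ (b₁ : K)) = -1}
    with hSf
  set Si := {w : InfinitePlace K |
    hilbertSymbol w.Completion (algebraMap K _ (a₁ : K)) (algebraMap K _ (b₁ : K)) = -1} with hSi
  set w₀ : InfinitePlace K := InfinitePlace.mk ((algebraMap ℝ ℂ).comp σ) with hw₀
  -- the infinite part
  have hSi_sub : Si ⊆ {w₀} := by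
    intro w hw
    rw [hSi, setOf_hilbertSymbol_completion_eq_neg_one ha₁K hb₁K, Set.mem_setOf_eq] at hw
    obtain ⟨hwr, -, hwb⟩ := hw
    rw [Set.mem_singleton_iff, ← embedding_of_isReal_eq_iff hwr]
    by_contra hne
    exact absurd hwb (not_lt.2 (hb₁φ _ hne).le)
  have hSi_mem : w₀ ∈ Si ↔ ¬ IsSquare (Ideal.Quotient.mk vb.asIdeal a') := by
    have hw₀r : w₀.IsReal := ⟨(algebraMap ℝ ℂ).comp σ, isReal_algebraMap_comp σ, rfl⟩
    have hemb : embedding_of_isReal hw₀r = σ := (embedding_of_isReal_eq_iff hw₀r σ).2 rfl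
    rw [hSi, setOf_hilbertSymbol_completion_eq_neg_one ha₁K hb₁K, Set.mem_setOf_eq, ← ha₁σ]
    constructor
    · rintro ⟨hw, ha, -⟩
      rwa [Subsingleton.elim hw hw₀r, hemb] at ha
    · intro ha
      exact ⟨hw₀r, by rwa [hemb], by rwa [hemb]⟩
  -- the finite part
  have hSf_sub : Sf ⊆ {va, vb} := by
    intro w hw
    rw [hSf, Set.mem_setOf_eq] at hw
    by_contra hnot
    simp only [Set.mem_insert_iff, Set.mem_singleton_iff, not_or] at hnot
    by_cases h2w : (2 : 𝓞 K) ∈ w.asIdeal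
    · rw [hilbertSymbol_eq_one_of_dyadic w h2w hb₁8 hb₁0] at hw
      norm_num at hw
    · have haw : a₁ ∉ w.asIdeal := fun h ↦ hnot.1 (by
        have hle : va.asIdeal ≤ w.asIdeal := by rw [hva]; exact (Ideal.span_singleton_le_iff_mem _).2 h
        exact (HeightOneSpectrum.ext (((va.isMaximal).eq_of_le w.isPrime.ne_top hle))).symm)
      have hbw : b₁ ∉ w.asIdeal := fun h ↦ hnot.2 (by
        have hle : vb.asIdeal ≤ w.asIdeal := by rw [hvb]; exact (Ideal.span_singleton_le_iff_mem _).2 h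
        exact (HeightOneSpectrum.ext (((vb.isMaximal).eq_of_le w.isPrime.ne_top hle))).symm)
      rw [hilbertSymbol_eq_one_of_not_mem w h2w ha₁0 haw hbw] at hw
      norm_num at hw
  have hSf_vb : vb ∈ Sf ↔ ¬ IsSquare (Ideal.Quotient.mk vb.asIdeal a') := by
    rw [hSf, Set.mem_setOf_eq, hilbertSymbol_comm,
      hilbertSymbol_eq_neg_one_iff_of_span_eq vb h2vb hvb ha₁vb, ha₁res]
  have hSf_va : va ∈ Sf ↔ ¬ IsSquare (Ideal.Quotient.mk va.asIdeal b₁) := by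
    rw [hSf, Set.mem_setOf_eq, hilbertSymbol_eq_neg_one_iff_of_span_eq va h2va hva hb₁va]
  -- parity: `b₁` is a square modulo `a₁`
  have hsqa : IsSquare (Ideal.Quotient.mk va.asIdeal b₁) := by
    by_contra hns
    have hva_mem : va ∈ Sf := hSf_va.2 hns
    by_cases hs : IsSquare (Ideal.Quotient.mk vb.asIdeal a')
    · have hSf_eq : Sf = {va} := by
        refine Set.Subset.antisymm (fun w hw ↦ ?_) (by simpa using hva_mem)
        rcases hSf_sub hw with h | h
        · exact h
        · exact absurd hs (hSf_vb.1 (h ▸ hw))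
      have hSi_eq : Si = ∅ := by
        refine Set.subset_empty_iff.1 fun w hw ↦ ?_
        have := hSi_sub hw
        rw [Set.mem_singleton_iff] at this
        exact absurd hs (hSi_mem.1 (this ▸ hw))
      rw [hSf_eq, hSi_eq, Set.ncard_singleton, Set.ncard_empty] at heven
      exact Nat.not_even_one heven
    · have hSf_eq : Sf = {va, vb} :=
        Set.Subset.antisymm hSf_sub (Set.insert_subset_iff.2 ⟨hva_mem,
          Set.singleton_subset_iff.2 (hSf_vb.2 hs)⟩)
      have hSi_eq : Si = {w₀} :=
        Set.Subset.antisymm hSi_sub (Set.singleton_subset_iff.2 (hSi_mem.2 hs))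
      rw [hSf_eq, hSi_eq, Set.ncard_pair hvavb, Set.ncard_singleton] at heven
      exact absurd heven (by decide)
  -- Step 5: `[b₁ q over a₁] = [c q over a₁]² = 1`
  obtain ⟨cbar, hcbar⟩ := hsqa
  obtain ⟨c, rfl⟩ := Ideal.Quotient.mk_surjective cbar
  rw [← map_mul, Ideal.Quotient.eq, hva] at hcbar
  obtain ⟨k₅, hk₅⟩ := Ideal.mem_span_singleton'.1 hcbar
  have ha₁c : IsCoprime a₁ c := by
    have : IsCoprime a₁ (b₁ + (-k₅) * a₁) := IsCoprime.add_mul_right_right ⟨c₁, c₂, hc⟩ _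
    rw [show b₁ + (-k₅) * a₁ = c * c by linear_combination -hk₅] at this
    exact this.of_mul_right_left
  have e4 : M.sym a₁ (b₁ * q) = M.sym a₁ (c * c * q) :=
    M.sym_mul_q_eq_of_sub_mem ha₁q (ha₁c.mul_right ha₁c) hcbar
  have e5 : M.sym a₁ (c * c * q) = M.sym a₁ (c * q) ^ 2 := by
    rw [M.sym_mul_q_pow ha₁q ha₁c 2, pow_two]
  rw [e1, e2, e3, e4, e5]
  exact M.sym_sq_eq_one σ ha₁q (hmulq c) (isCoprime_mul_q ha₁q ha₁c)

end MennickeSymbol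

end SerreSL2

end Literature.NumberTheory.Automorphic
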